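import Summits.NavierStokesRegularity.FluidComputer.LeraySupClock
import Summits.NavierStokesRegularity.FluidComputer.CriticalLevels
import HarnessLib

/-!
# Fluid computer — the SOBOLEV LADDER of the level dictionary (L51): one clock per level currency
# `s ∈ (1/2, 3/2]`, with the scaling-sharp exponent `(2s − 1)/4`

HONEST FRAMING (cell `pub-fluidc`, verbatim): *low prior, high value-of-information experiment on Tao's
machine paradigm; NOT a claim that NS blows up.* Theorem side of the cell; nothing here is evidence of blow-up.

The dictionary so far reads a realised blow-up through THREE weighted rows of the level table
`a_j(t) = ‖Δ̇_j u(t)‖₂`: the critical row `2^{j/2} a_j` (L29, Kato/Seregin: floor `δν`, no rate), the enstrophy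
row `4^j a_j²` (L20, Leray: rate `(T − t)^{−1/2}` for the squares) and the block-sup row `s_j ≤ C_B 2^{3j/2} a_j`
(L22, Leray: rate `(T − t)^{−1/2}`). This module fills in the CONTINUUM between them: for every Sobolev index
`s ∈ (1/2, 3/2]` the `Ḃ^s_{2,1}` row `L_s(t) = ∑_{j ∈ ℤ} 2^{sj} ‖Δ̇_j u(t)‖₂` obeys, along every maximal smooth
Leray–Hopf solution of the unforced Navier–Stokes system on `ℝ³` (`ν > 0`),

  `c_s · ν^{(5−2s)/4} · (T − t)^{−(2s−1)/4} ≤ L_s(t)` at EVERY `t ∈ (0, T)` (`ladder_clock`, **L51**),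

with `c_s > 0` depending on `s` only. The exponent `(2s − 1)/4` is the one dictated by the Navier–Stokes scaling
(`‖u‖_{Ḣ^s}` has the dimension of `ν^{(5−2s)/4} (time)^{−(2s−1)/4}`) and is the exponent of the printed OPTIMAL lower
bounds `‖u(T − τ)‖_{Ḣ^s} ≥ c τ^{−(2s−1)/4}` (Robinson–Sadowski–Silva 2012 for `s < 5/2`; Robinson–Sadowski 2014
Cor. 10 for `1/2 < s < 3/2` by exactly the route taken here: Leray's `L^p` rates + Sobolev embedding). At `s = 1`
it is Leray's `1/4`, at `s = 3/2` the sup-norm's `1/2`; as `s ↓ 1/2` it degenerates to the rate-free floor L29.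

PROOF ROUTE (nothing beyond the tree's Littlewood–Paley toolbox). For `1/2 < s < 3/2` put `r = 6/(3 − 2s)`:
`eLpNorm_le_tsum_block` (LP summation in `L^r`, `‖v‖_r ≤ ∑_j ‖Δ̇_j v‖_r`, the tree's `eLpNormDistrib_le_tsum_lpBlock`
read through the distribution of `v ∈ L² ∩ L^r`); `eLpNorm_le_mixed_rpow` (interpolation on a block with a REAL
exponent, `‖Δ̇_j v‖_r ≤ (s_j^{r−2} a_j²)^{1/r}`); `exists_mixed_le_ladder` (Bernstein `s_j ≤ C_B 2^{3j/2} a_j`: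
`(s_j^{r−2} a_j²)^{1/r} ≤ max(1, C_B) · 2^{(3/2 − 3/r) j} a_j`, `3/2 − 3/r = s` — ONE constant for the whole ladder;
`exists_eLpNorm_le_tsum_ladder` is the embedding `Ḃ^{3/2−3/r}_{2,1} ⊂ L^r` at function level); and L21′
`LeraySupClock.Lr_clock`, `c_r ν^{(r+3)/(2r)} (T − t)^{−(r−3)/(2r)} ≤ ‖u(t)‖_{L^r}` with `(r+3)/(2r) = (5−2s)/4`,
`(r−3)/(2r) = (2s−1)/4`. The endpoint `s = 3/2` (`r = ∞`; `Ḣ^{3/2} ⊄ L^∞` but `Ḃ^{3/2}_{2,1} ⊂ L^∞`) is L22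
(`blockSup_sum_clock`) and Bernstein; `memLp_slice` records `u(t) ∈ L^r`, `2 ≤ r < ∞`. The companion module
`SobolevLadderFront` adds the divergence of every row (L51′), the per-level countdown and the tail divergence.

Reading for the atlas. A DNS reader holds shell energies `E_j(t) ≈ a_j(t)²`; the rows `L_s(t) = ∑_j 2^{sj} √E_j(t)`
are one line each, for a continuum of `s`. The necessity: against `T − t` on log axes EVERY such row eventually
lies above a line of slope `−(2s−1)/4` (`0⁺` at the critical end, `−1/4` at the enstrophy level, `−1/2` at the
amplitude end), and the family of slopes is rigid (linear in `s`). HONEST SIZE NOTE: `c_s` is inexplicit (Leray's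
`L^r` constant through ns.S28 × a Bernstein constant), degenerates as `s ↓ 1/2` and is not claimed uniform as
`s ↑ 3/2`; the statement is in `Ḃ^s_{2,1}` currency (an `ℓ¹` sum over levels), WEAKER than the printed `Ḣ^s`
(`ℓ²`) bound for `s < 3/2` and the right currency at `s = 3/2`; above `3/2` nothing optimal is claimed here. Words
and shapes for the writer, never numbers at the cell's levels. Necessity only; nothing about sufficiency.
0 sorry; no new definitions, no named facts.

## References

* J. Leray, *Sur le mouvement d'un liquide visqueux emplissant l'espace*, Acta Math. 63 (1934), §19
  (3.8)–(3.9) p. 224, §22 p. 227. [Leray1934]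
* J. C. Robinson, W. Sadowski, *A local smoothness criterion for solutions of the 3D Navier–Stokes equations*,
  Rend. Semin. Mat. Univ. Padova 131 (2014) 159–178, Corollaries 9–10. [RobinsonSadowski2014]
* J. C. Robinson, W. Sadowski, R. P. Silva, *Lower bounds on blow up solutions of the three-dimensional
  Navier–Stokes equations in homogeneous Sobolev spaces*, J. Math. Phys. 53 (2012) 115618. [RobinsonSadowskiSilva2012]
* H. Bahouri, J.-Y. Chemin, R. Danchin, *Fourier Analysis and Nonlinear PDE*, Springer 2011, Lemma 2.1,
  Prop. 2.12. [BahouriCheminDanchin2011]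
-/

noncomputable section

open MeasureTheory Set Function Filter Topology Metric
open scoped ENNReal NNReal SchwartzMap
open Literature.Analysis.FluidPDE Literature.Analysis.FunctionSpaces
open Summit.NavierStokesRegularity.FluidComputer.BlockAmplitudeCeiling
open Summit.NavierStokesRegularity.FluidComputer.LeraySupClock
open Summit.NavierStokesRegularity.FluidComputer.CriticalLevels

namespace Summit.NavierStokesRegularity.FluidComputer.SobolevLadder

/-! ## Interpolation on a slice with a real exponent -/

/-- `∫ ‖g‖ₑ^r ≤ ‖g‖_{L^∞}^{r−2} · ∫ ‖g‖ₑ²` for every real `r ≥ 2` (pull `r − 2` factors out by the essential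
supremum). [folklore] -/
theorem lintegral_rpow_le_essSup_rpow_mul {α : Type*} {m0 : MeasurableSpace α} {μ : Measure α}
    {G : Type*} [NormedAddCommGroup G] {g : α → G} (hg : AEStronglyMeasurable g μ) {r : ℝ} (hr : 2 ≤ r) :
    ∫⁻ x, ‖g x‖ₑ ^ r ∂μ ≤ eLpNorm g ∞ μ ^ (r - 2) * ∫⁻ x, ‖g x‖ₑ ^ 2 ∂μ := by
  have hsplit : ∀ x, ‖g x‖ₑ ^ r = ‖g x‖ₑ ^ (r - 2) * ‖g x‖ₑ ^ 2 := fun x => by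
    rw [← ENNReal.rpow_two, ← ENNReal.rpow_add_of_nonneg _ _ (by linarith) (by norm_num)]
    congr 1
    ring
  simp_rw [hsplit]
  rw [← lintegral_const_mul'' _ (hg.enorm.pow_const 2)]
  refine lintegral_mono_ae ?_
  filter_upwards [ae_le_eLpNormEssSup (μ := μ) (f := g)] with x hx
  rw [eLpNorm_exponent_top]
  gcongr

/-- **Interpolation `L² ∩ L^∞ ⊂ L^r` with a real exponent**: for `2 ≤ r < ∞` (`r : ℝ≥0`),
`‖g‖_{L^r} ≤ (‖g‖_{L^∞}^{r−2} ‖g‖_{L²}²)^{1/r}`. [folklore] -/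
theorem eLpNorm_le_mixed_rpow {α : Type*} {m0 : MeasurableSpace α} {μ : Measure α}
    {G : Type*} [NormedAddCommGroup G] {g : α → G} (hg : AEStronglyMeasurable g μ) {r : ℝ≥0} (hr : 2 ≤ r) :
    eLpNorm g r μ ≤ (eLpNorm g ∞ μ ^ ((r : ℝ) - 2) * eLpNorm g 2 μ ^ 2) ^ (1 / (r : ℝ)) := by
  have hr' : (2 : ℝ) ≤ r := by exact_mod_cast hr
  have hrpos : (0 : ℝ) < r := by linarith
  have hr0 : r ≠ 0 := by
    intro h
    rw [h] at hrpos
    simp at hrpos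
  have h1 : eLpNorm g r μ ^ (r : ℝ) = ∫⁻ x, ‖g x‖ₑ ^ (r : ℝ) ∂μ := eLpNorm_nnreal_pow_eq_lintegral hr0
  have h2 : eLpNorm g 2 μ ^ 2 = ∫⁻ x, ‖g x‖ₑ ^ 2 ∂μ := by
    have := eLpNorm_natCast_pow_eq_lintegral μ g (n := 2) (by norm_num)
    simpa only [Nat.cast_ofNat] using this
  have h3 : ∫⁻ x, ‖g x‖ₑ ^ (r : ℝ) ∂μ ≤ eLpNorm g ∞ μ ^ ((r : ℝ) - 2) * eLpNorm g 2 μ ^ 2 := by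
    rw [h2]
    exact lintegral_rpow_le_essSup_rpow_mul hg hr'
  calc eLpNorm g r μ = (eLpNorm g r μ ^ (r : ℝ)) ^ (1 / (r : ℝ)) := by
        rw [one_div, ENNReal.rpow_rpow_inv hrpos.ne']
    _ ≤ _ := by
        rw [h1]
        exact ENNReal.rpow_le_rpow h3 (by positivity)

/-- **`L² ∩ L^∞ ⊂ L^r`, quantitatively**: an `L²` field bounded pointwise by `B` lies in `L^r` for every
`2 ≤ r < ∞`. [folklore] -/
theorem memLp_of_memLp_two_of_norm_le {α : Type*} {m0 : MeasurableSpace α} {μ : Measure α}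
    {G : Type*} [NormedAddCommGroup G] {g : α → G} (hg2 : MemLp g 2 μ) {B : ℝ} (hB : ∀ x, ‖g x‖ ≤ B)
    {r : ℝ≥0} (hr : 2 ≤ r) : MemLp g r μ := by
  have hmeas : AEStronglyMeasurable g μ := hg2.1
  have hr' : (2 : ℝ) ≤ r := by exact_mod_cast hr
  have hS : eLpNorm g ∞ μ ≤ ENNReal.ofReal B := by
    rw [eLpNorm_exponent_top]
    exact eLpNormEssSup_le_of_ae_bound (Eventually.of_forall hB)
  refine ⟨hmeas, (eLpNorm_le_mixed_rpow hmeas hr).trans_lt ?_⟩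
  refine ENNReal.rpow_lt_top_of_nonneg (by positivity) (ENNReal.mul_ne_top ?_ ?_)
  · exact ENNReal.rpow_ne_top_of_nonneg (by linarith) (ne_top_of_le_ne_top ENNReal.ofReal_ne_top hS)
  · exact ENNReal.pow_ne_top hg2.eLpNorm_ne_top

/-! ## Littlewood–Paley summation in `L^r` and the ladder embedding at function level -/

/-- **Littlewood–Paley summation in `L^q`**: for `1 ≤ q` and `v ∈ L² ∩ L^q(ℝ³; ℝ³)`,
`‖v‖_{L^q} ≤ ∑_{j∈ℤ} ‖Δ̇_j v‖_{L^q}` (in `[0, ∞]`). The distribution of the `L²` field `v` has vanishing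
low-frequency cut-offs (`tendsto_lowFreqCutoff_of_memLp_two_holds`), so the `ℓ¹`-Minkowski bound
`eLpNormDistrib_le_tsum_lpBlock` applies; distributional norms are function norms for `L^q` fields.
[cite: BahouriCheminDanchin2011, Prop. 2.12] -/
theorem eLpNorm_le_tsum_block {v : EuclideanSpace ℝ (Fin 3) → EuclideanSpace ℝ (Fin 3)} {q : ℝ≥0∞}
    [Fact (1 ≤ q)] (hv2 : MemLp v 2 volume) (hvq : MemLp v q volume) :
    eLpNorm v q volume ≤ ∑' j : ℤ, eLpNorm (blockFn j v) q volume := by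
  set V : 𝓢'(EuclideanSpace ℝ (Fin 3), EuclideanSpace ℂ (Fin 3)) :=
    Lp.toTemperedDistribution ((memLp_complexify_comp hv2).toLp _) with hVdef
  have hV : IsDistributionOf v V := isDistributionOf_toTemperedDistribution hv2
  have h1 : eLpNorm v q volume = eLpNormDistrib q V := (hV.eLpNormDistrib_eq hvq).symm
  have h0 : Tendsto (fun j : ℤ => lowFreqCutoff j V) atBot (𝓝 0) :=
    tendsto_lowFreqCutoff_of_memLp_two_holds hv2 hV
  have h2 : eLpNormDistrib q V ≤ ∑' j : ℤ, eLpNormDistrib q (lpBlock j V) := eLpNormDistrib_le_tsum_lpBlock _ h0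
  rw [h1]
  refine h2.trans_eq (tsum_congr fun j => ?_)
  exact hV.eLpNormDistrib_lpBlock_eq hv2 j (memLp_blockFn j hvq Fact.out)

/-- **Bernstein on the `L^r` row: ONE constant for the whole ladder.** With the absolute Bernstein constant `C_B`
of `BlockAmplitudeCeiling.exists_blockSup_le_blockL2` (`s_j ≤ C_B 2^{3j/2} a_j`), for every `v ∈ L²`, every
`2 ≤ r < ∞` and every level `j`: `(s_j^{r−2} a_j²)^{1/r} ≤ max(1, C_B) · 2^{(3/2 − 3/r) j} a_j`
(`C_B^{(r−2)/r} ≤ max(1, C_B)` because `0 ≤ (r−2)/r < 1`). [cite: BahouriCheminDanchin2011, Lemma 2.1] -/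
theorem exists_mixed_le_ladder :
    ∃ C : ℝ≥0, ∀ (v : EuclideanSpace ℝ (Fin 3) → EuclideanSpace ℝ (Fin 3)), MemLp v 2 volume →
      ∀ (r : ℝ≥0), 2 ≤ r → ∀ j : ℤ,
        (blockSup v j ^ ((r : ℝ) - 2) * blockL2 v j ^ 2) ^ (1 / (r : ℝ)) ≤
          C * ((2 : ℝ≥0∞) ^ ((3 / 2 - 3 / (r : ℝ)) * (j : ℝ)) * blockL2 v j) := by
  obtain ⟨CB, -, hB⟩ := exists_blockSup_le_blockL2
  refine ⟨max 1 CB, fun v hv r hr j => ?_⟩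
  set a : ℝ≥0∞ := blockL2 v j with ha
  have hr' : (2 : ℝ) ≤ r := by exact_mod_cast hr
  have hrpos : (0 : ℝ) < r := by linarith
  have hr2 : (0 : ℝ) ≤ (r : ℝ) - 2 := by linarith
  set θ : ℝ := ((r : ℝ) - 2) / r with hθ
  have hθ0 : 0 ≤ θ := div_nonneg hr2 hrpos.le
  have hθ1 : θ ≤ 1 := by
    rw [hθ, div_le_one hrpos]
    linarith
  -- step 1: Bernstein inside the `(r − 2)`-th power
  have h1 : blockSup v j ^ ((r : ℝ) - 2) ≤
      ((CB : ℝ≥0∞) * (2 : ℝ≥0∞) ^ (3 * (j : ℝ) / 2) * a) ^ ((r : ℝ) - 2) :=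
    ENNReal.rpow_le_rpow (hB v hv j) hr2
  -- step 2: collect the powers of `a`
  have h2 : ((CB : ℝ≥0∞) * (2 : ℝ≥0∞) ^ (3 * (j : ℝ) / 2) * a) ^ ((r : ℝ) - 2) * a ^ 2 =
      (CB : ℝ≥0∞) ^ ((r : ℝ) - 2) * (2 : ℝ≥0∞) ^ (3 * (j : ℝ) / 2 * ((r : ℝ) - 2)) * a ^ (r : ℝ) := by
    rw [ENNReal.mul_rpow_of_nonneg _ _ hr2, ENNReal.mul_rpow_of_nonneg _ _ hr2, ← ENNReal.rpow_mul,
      ← ENNReal.rpow_two, mul_assoc, ← ENNReal.rpow_add_of_nonneg _ _ hr2 (by norm_num)]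
    congr 2
    ring
  -- step 3: the `r`-th root
  have h3 : ((CB : ℝ≥0∞) ^ ((r : ℝ) - 2) * (2 : ℝ≥0∞) ^ (3 * (j : ℝ) / 2 * ((r : ℝ) - 2)) * a ^ (r : ℝ)) ^
        (1 / (r : ℝ)) = (CB : ℝ≥0∞) ^ θ * (2 : ℝ≥0∞) ^ ((3 / 2 - 3 / (r : ℝ)) * (j : ℝ)) * a := by
    rw [ENNReal.mul_rpow_of_nonneg _ _ (by positivity), ENNReal.mul_rpow_of_nonneg _ _ (by positivity),
      ← ENNReal.rpow_mul, ← ENNReal.rpow_mul, ← ENNReal.rpow_mul]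
    have e1 : ((r : ℝ) - 2) * (1 / (r : ℝ)) = θ := by rw [hθ]; ring
    have e2 : 3 * (j : ℝ) / 2 * ((r : ℝ) - 2) * (1 / (r : ℝ)) = (3 / 2 - 3 / (r : ℝ)) * (j : ℝ) := by
      field_simp
    have e3 : (r : ℝ) * (1 / (r : ℝ)) = 1 := by field_simp
    rw [e1, e2, e3, ENNReal.rpow_one]
  -- step 4: `C_B^θ ≤ max 1 C_B`
  have h4 : (CB : ℝ≥0∞) ^ θ ≤ ((max 1 CB : ℝ≥0) : ℝ≥0∞) := by
    rcases le_or_gt (1 : ℝ≥0) CB with hC1 | hC1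
    · calc (CB : ℝ≥0∞) ^ θ ≤ (CB : ℝ≥0∞) ^ (1 : ℝ) :=
            ENNReal.rpow_le_rpow_of_exponent_le (by exact_mod_cast hC1) hθ1
        _ = CB := ENNReal.rpow_one _
        _ ≤ _ := by exact_mod_cast le_max_right 1 CB
    · calc (CB : ℝ≥0∞) ^ θ ≤ 1 := ENNReal.rpow_le_one (by exact_mod_cast hC1.le) hθ0
        _ ≤ _ := by exact_mod_cast le_max_left 1 CB
  calc (blockSup v j ^ ((r : ℝ) - 2) * a ^ 2) ^ (1 / (r : ℝ))
      ≤ (((CB : ℝ≥0∞) * (2 : ℝ≥0∞) ^ (3 * (j : ℝ) / 2) * a) ^ ((r : ℝ) - 2) * a ^ 2) ^ (1 / (r : ℝ)) :=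
        ENNReal.rpow_le_rpow (mul_le_mul' h1 le_rfl) (by positivity)
    _ = (CB : ℝ≥0∞) ^ θ * (2 : ℝ≥0∞) ^ ((3 / 2 - 3 / (r : ℝ)) * (j : ℝ)) * a := by rw [h2, h3]
    _ ≤ ((max 1 CB : ℝ≥0) : ℝ≥0∞) * ((2 : ℝ≥0∞) ^ ((3 / 2 - 3 / (r : ℝ)) * (j : ℝ)) * a) := by
        rw [← mul_assoc]
        exact mul_le_mul' (mul_le_mul' h4 le_rfl) le_rfl

/-- **THE LADDER EMBEDDING AT FUNCTION LEVEL** (`Ḃ^{3/2−3/r}_{2,1} ⊂ L^r`): there is ONE absolute constant `C`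
(`= max(1, C_B)`) such that for every `2 ≤ r < ∞` and every `v ∈ L² ∩ L^r(ℝ³; ℝ³)`:
`‖v‖_{L^r} ≤ C ∑_{j∈ℤ} 2^{(3/2 − 3/r) j} ‖Δ̇_j v‖₂` (Littlewood–Paley summation in `L^r`, interpolation block by
block, Bernstein). At `r = 3` this is gen 15's `exists_eLpNorm_three_le_tsum_besovHalf` (weights `2^{j/2}`).
[cite: BahouriCheminDanchin2011, Lemma 2.1 and Prop. 2.12] -/
theorem exists_eLpNorm_le_tsum_ladder :
    ∃ C : ℝ≥0, ∀ (v : EuclideanSpace ℝ (Fin 3) → EuclideanSpace ℝ (Fin 3)), MemLp v 2 volume →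
      ∀ (r : ℝ≥0), 2 ≤ r → MemLp v r volume →
        eLpNorm v r volume ≤ C * ∑' j : ℤ, (2 : ℝ≥0∞) ^ ((3 / 2 - 3 / (r : ℝ)) * (j : ℝ)) * blockL2 v j := by
  obtain ⟨C, hC⟩ := exists_mixed_le_ladder
  refine ⟨C, fun v hv2 r hr hvr => ?_⟩
  haveI : Fact (1 ≤ (r : ℝ≥0∞)) := ⟨by exact_mod_cast one_le_two.trans hr⟩
  refine (eLpNorm_le_tsum_block hv2 hvr).trans ?_
  rw [← ENNReal.tsum_mul_left]
  refine ENNReal.tsum_le_tsum fun j => ?_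
  exact (eLpNorm_le_mixed_rpow (memLp_blockFn j hvr Fact.out).1 hr).trans (hC v hv2 r hr j)

/-! ## L51: the Sobolev ladder of clocks along a maximal solution -/

/-- **Slices are in every `L^r`, `2 ≤ r < ∞`**: a classical solution of the unforced system on `ℝ³ × [0, T)`
(`ν > 0`), Leray–Hopf from `u 0`, has `u(t) ∈ L^r` at every `t ∈ (0, T)` — `L²` by the energy class, bounded by
interior boundedness (`LeraySupClock.exists_bound_window`: far-field ε-regularity + compact continuity).
[cite: LemarieRieusset2016, proof of Thm. 14.5 (p. 512) with Thm. 14.4 (p. 505)] -/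
theorem memLp_slice {ν T : ℝ} (hν : 0 < ν) (hT : 0 < T)
    {u : ℝ → EuclideanSpace ℝ (Fin 3) → EuclideanSpace ℝ (Fin 3)} {p : ℝ → EuclideanSpace ℝ (Fin 3) → ℝ}
    (hcl : IsClassicalNSSolutionOn (Ico 0 T) ν 0 u p) (hLH : IsLerayHopfOn T ν 0 (u 0) u)
    {t : ℝ} (ht : t ∈ Ioo 0 T) {r : ℝ≥0} (hr : 2 ≤ r) : MemLp (u t) r volume := by
  obtain ⟨M, hM⟩ := exists_bound_window hν hT hcl hLH ht.1 (T' := t) ht.2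
  exact memLp_of_memLp_two_of_norm_le (hLH.memLp t ⟨ht.1.le, ht.2.le⟩) (fun x => hM t ⟨le_rfl, le_rfl⟩ x) hr

/-- **L51, Lebesgue-exponent form.** For every `3 < r < ∞` there is `c > 0` such that along every maximal smooth
solution `(u, p)` of the unforced Navier–Stokes system on `ℝ³ × [0, T)` (`ν > 0`) which is Leray–Hopf from `u 0`,
at EVERY `t ∈ (0, T)`:
`c · ν^{(r+3)/(2r)} · (T − t)^{−(r−3)/(2r)} ≤ ∑_{j∈ℤ} 2^{(3/2 − 3/r) j} ‖Δ̇_j u(t)‖₂`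
(Leray's `L^r` clock L21′ `LeraySupClock.Lr_clock` and the ladder embedding `exists_eLpNorm_le_tsum_ladder`).
[cite: Leray1934, §22 p. 227] [cite: RobinsonSadowski2014, Corollaries 9–10]
[cite: BahouriCheminDanchin2011, Lemma 2.1 and Prop. 2.12] -/
theorem ladder_clock_exponent (r : ℝ) (hr : 3 < r) :
    ∃ c : ℝ, 0 < c ∧ ∀ (ν T : ℝ), 0 < ν → 0 < T →
      ∀ (u : ℝ → EuclideanSpace ℝ (Fin 3) → EuclideanSpace ℝ (Fin 3)) (p : ℝ → EuclideanSpace ℝ (Fin 3) → ℝ),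
      IsMaximalSmoothSolution ν 0 u p T → IsLerayHopfOn T ν 0 (u 0) u →
      ∀ t ∈ Ioo 0 T,
        ENNReal.ofReal (c * ν ^ ((r + 3) / (2 * r)) * (T - t) ^ (-((r - 3) / (2 * r)))) ≤
          ∑' j : ℤ, (2 : ℝ≥0∞) ^ ((3 / 2 - 3 / r) * (j : ℝ)) * blockL2 (u t) j := by
  obtain ⟨c, hc, H⟩ := Lr_clock r hr
  obtain ⟨C, hC⟩ := exists_eLpNorm_le_tsum_ladder
  set C' : ℝ≥0 := max C 1 with hC'
  have hC'pos : (0 : ℝ) < C' := by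
    have : (1 : ℝ≥0) ≤ C' := le_max_right _ _
    exact lt_of_lt_of_le one_pos (by exact_mod_cast this)
  refine ⟨c / C', div_pos hc hC'pos, fun ν T hν hT u p hmax hLH t ht => ?_⟩
  set rn : ℝ≥0 := r.toNNReal with hrn
  have hrn' : (rn : ℝ) = r := Real.coe_toNNReal _ (by linarith)
  have hrn2 : 2 ≤ rn := by
    rw [← NNReal.coe_le_coe, hrn']
    push_cast
    linarith
  have hslice : MemLp (u t) rn volume := memLp_slice hν hT hmax.1 hLH ht hrn2
  have hofReal : ENNReal.ofReal r = (rn : ℝ≥0∞) := rfl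
  have h1 := H ν T hν hT u p hmax hLH t ht
  have h2 := hC (u t) (hLH.memLp t ⟨ht.1.le, ht.2.le⟩) rn hrn2 hslice
  rw [hrn', ← hofReal] at h2
  set S : ℝ≥0∞ := ∑' j : ℤ, (2 : ℝ≥0∞) ^ ((3 / 2 - 3 / r) * (j : ℝ)) * blockL2 (u t) j with hS
  set X : ℝ := ν ^ ((r + 3) / (2 * r)) * (T - t) ^ (-((r - 3) / (2 * r))) with hX
  have hTt : 0 < T - t := sub_pos.2 ht.2
  have h3 : ENNReal.ofReal (c * X) ≤ (C' : ℝ≥0∞) * S := by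
    have e : c * X = c * ν ^ ((r + 3) / (2 * r)) * (T - t) ^ (-((r - 3) / (2 * r))) := by rw [hX]; ring
    rw [e]
    refine (h1.trans h2).trans (mul_le_mul' ?_ le_rfl)
    exact_mod_cast le_max_left C 1
  have h4 : ENNReal.ofReal (c / C' * ν ^ ((r + 3) / (2 * r)) * (T - t) ^ (-((r - 3) / (2 * r)))) =
      ENNReal.ofReal (c * X) / C' := by
    have e : c / C' * ν ^ ((r + 3) / (2 * r)) * (T - t) ^ (-((r - 3) / (2 * r))) = c * X / C' := by
      rw [hX]; ring
    rw [e, ENNReal.ofReal_div_of_pos hC'pos, ENNReal.ofReal_coe_nnreal]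
  rw [h4, ENNReal.div_le_iff (by exact_mod_cast hC'pos.ne') ENNReal.coe_ne_top]
  calc ENNReal.ofReal (c * X) ≤ (C' : ℝ≥0∞) * S := h3
    _ = S * C' := mul_comm _ _

/-- **L51, the endpoint `s = 3/2` (`Ḃ^{3/2}_{2,1}` currency, where `Ḣ^{3/2} ⊄ L^∞`).** There is an absolute
`c > 0` such that along every maximal smooth Leray–Hopf solution of the unforced system (`ν > 0`), at EVERY
`t ∈ (0, T)`: `c · ν^{1/2} · (T − t)^{−1/2} ≤ ∑_{j∈ℤ} 2^{3j/2} ‖Δ̇_j u(t)‖₂` — Leray's sup-norm clock in block-sup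
currency (L22, `LeraySupClock.blockSup_sum_clock`) and Bernstein `s_j ≤ C_B 2^{3j/2} a_j`. The exponent `1/2` is
the scaling-sharp one at `s = 3/2`. [cite: Leray1934, §19 (3.8)–(3.9) p. 224]
[cite: BahouriCheminDanchin2011, Lemma 2.1 and Prop. 2.12] -/
theorem ladder_clock_threeHalves :
    ∃ c : ℝ, 0 < c ∧ ∀ (ν T : ℝ), 0 < ν → 0 < T →
      ∀ (u : ℝ → EuclideanSpace ℝ (Fin 3) → EuclideanSpace ℝ (Fin 3)) (p : ℝ → EuclideanSpace ℝ (Fin 3) → ℝ),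
      IsMaximalSmoothSolution ν 0 u p T → IsLerayHopfOn T ν 0 (u 0) u →
      ∀ t ∈ Ioo 0 T,
        ENNReal.ofReal (c * ν ^ ((5 - 2 * (3 / 2 : ℝ)) / 4) * (T - t) ^ (-((2 * (3 / 2 : ℝ) - 1) / 4))) ≤
          ∑' j : ℤ, (2 : ℝ≥0∞) ^ ((3 / 2 : ℝ) * (j : ℝ)) * blockL2 (u t) j := by
  obtain ⟨c, hc, H⟩ := blockSup_sum_clock
  obtain ⟨CB, hCB0, hB⟩ := exists_blockSup_le_blockL2
  have hCBpos : (0 : ℝ) < CB := by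
    have : 0 < CB := pos_iff_ne_zero.2 hCB0
    exact_mod_cast this
  refine ⟨c / CB, div_pos hc hCBpos, fun ν T hν hT u p hmax hLH t ht => ?_⟩
  have hTt : 0 < T - t := sub_pos.2 ht.2
  have hut : MemLp (u t) 2 volume := hLH.memLp t ⟨ht.1.le, ht.2.le⟩
  set S : ℝ≥0∞ := ∑' j : ℤ, (2 : ℝ≥0∞) ^ ((3 / 2 : ℝ) * (j : ℝ)) * blockL2 (u t) j with hS
  -- the sum of the block sups is at most `C_B` times the `3/2`-row
  have hsum : ∑' j : ℤ, blockSup (u t) j ≤ (CB : ℝ≥0∞) * S := by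
    rw [hS, ← ENNReal.tsum_mul_left]
    refine ENNReal.tsum_le_tsum fun j => ?_
    rw [← mul_assoc]
    refine (hB (u t) hut j).trans_eq ?_
    congr 2
    congr 1
    ring
  have h1 : ENNReal.ofReal (c * Real.sqrt ν / Real.sqrt (T - t)) ≤ (CB : ℝ≥0∞) * S :=
    (H ν T hν hT u p hmax hLH t ht).trans hsum
  -- rewrite the square roots as the ladder's powers at `s = 3/2`
  have e1 : c * Real.sqrt ν / Real.sqrt (T - t) =
      c * ν ^ ((5 - 2 * (3 / 2 : ℝ)) / 4) * (T - t) ^ (-((2 * (3 / 2 : ℝ) - 1) / 4)) := by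
    rw [Real.sqrt_eq_rpow, Real.sqrt_eq_rpow, div_eq_mul_inv, ← Real.rpow_neg hTt.le]
    norm_num
  have h4 : ENNReal.ofReal (c / CB * ν ^ ((5 - 2 * (3 / 2 : ℝ)) / 4) * (T - t) ^ (-((2 * (3 / 2 : ℝ) - 1) / 4))) =
      ENNReal.ofReal (c * Real.sqrt ν / Real.sqrt (T - t)) / CB := by
    rw [e1, ← ENNReal.ofReal_coe_nnreal, ← ENNReal.ofReal_div_of_pos hCBpos]
    congr 1
    ring
  rw [h4, ENNReal.div_le_iff (by exact_mod_cast hCB0) ENNReal.coe_ne_top]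
  calc ENNReal.ofReal (c * Real.sqrt ν / Real.sqrt (T - t)) ≤ (CB : ℝ≥0∞) * S := h1
    _ = S * CB := mul_comm _ _

/-- **L51 — THE SOBOLEV LADDER.** For every Sobolev index `s ∈ (1/2, 3/2]` there is `c = c_s > 0` such that for every
`ν > 0`, `T > 0` and every maximal smooth solution `(u, p)` of the unforced Navier–Stokes system on `ℝ³ × [0, T)`
which is Leray–Hopf from `u 0`, at EVERY `t ∈ (0, T)`:

  `c · ν^{(5−2s)/4} · (T − t)^{−(2s−1)/4} ≤ ∑_{j∈ℤ} 2^{sj} ‖Δ̇_j u(t)‖₂`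

— the `Ḃ^s_{2,1}` row of the level table runs on Leray's clock with the SCALING-SHARP exponent `(2s−1)/4`
(`1/4` at the enstrophy level `s = 1`, `1/2` at the amplitude end `s = 3/2`, `→ 0` at the critical end). For
`s < 3/2`: `ladder_clock_exponent` at `r = 6/(3 − 2s)`; at `s = 3/2`: `ladder_clock_threeHalves`. The printed
`Ḣ^s` lower bounds with this exponent are Robinson–Sadowski–Silva 2012 / Robinson–Sadowski 2014 Cor. 10; the
`ℓ¹`-over-levels form here is weaker than `Ḣ^s` for `s < 3/2` and is the natural one at `s = 3/2`.
[cite: RobinsonSadowski2014, Corollary 10] [cite: RobinsonSadowskiSilva2012, Thm. 1.1] [cite: Leray1934, §22 p. 227]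
[cite: BahouriCheminDanchin2011, Lemma 2.1 and Prop. 2.12] -/
theorem ladder_clock (s : ℝ) (hs : s ∈ Ioc (1 / 2 : ℝ) (3 / 2)) :
    ∃ c : ℝ, 0 < c ∧ ∀ (ν T : ℝ), 0 < ν → 0 < T →
      ∀ (u : ℝ → EuclideanSpace ℝ (Fin 3) → EuclideanSpace ℝ (Fin 3)) (p : ℝ → EuclideanSpace ℝ (Fin 3) → ℝ),
      IsMaximalSmoothSolution ν 0 u p T → IsLerayHopfOn T ν 0 (u 0) u →
      ∀ t ∈ Ioo 0 T,
        ENNReal.ofReal (c * ν ^ ((5 - 2 * s) / 4) * (T - t) ^ (-((2 * s - 1) / 4))) ≤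
          ∑' j : ℤ, (2 : ℝ≥0∞) ^ (s * (j : ℝ)) * blockL2 (u t) j := by
  rcases eq_or_lt_of_le hs.2 with h32 | h32
  · rw [h32]
    exact ladder_clock_threeHalves
  set r : ℝ := 6 / (3 - 2 * s) with hr
  have h3 : 0 < 3 - 2 * s := by linarith
  have hr3 : 3 < r := by
    rw [hr, lt_div_iff₀ h3]
    linarith [hs.1]
  have e1 : (r + 3) / (2 * r) = (5 - 2 * s) / 4 := by
    rw [hr]
    field_simp
    ring
  have e2 : (r - 3) / (2 * r) = (2 * s - 1) / 4 := by
    rw [hr]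
    field_simp
    ring
  have e3 : 3 / 2 - 3 / r = s := by
    rw [hr]
    field_simp
    ring
  obtain ⟨c, hc, H⟩ := ladder_clock_exponent r hr3
  refine ⟨c, hc, fun ν T hν hT u p hmax hLH t ht => ?_⟩
  have h := H ν T hν hT u p hmax hLH t ht
  rw [e1, e2, e3] at h
  exact h

end Summit.NavierStokesRegularity.FluidComputer.SobolevLadder

end
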